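import Literature.NumberTheory.LFunctions.GaussianThetaFunctionalEquation
import Mathlib.NumberTheory.LegendreSymbol.JacobiSymbol
import Mathlib.FieldTheory.Finite.Basic
import HarnessLib

/-!
# The quadratic Gauss sum of the norm form of `ℤ[i]`

For an odd prime `p` and the quadratic character `χ = (·/p)` of `𝔽_p`, the two-dimensional Gauss
sum of the norm form,
`S(z) = ∑_{(a, b) ∈ 𝔽_p²} χ(a² + b²) e^{2πi (a z₁ + b z₂)/p}`,
equals `χ(z₁² + z₂²) · p` for every `z ∈ 𝔽_p²` (`Literature.NumberTheory.QuadraticFields.GaussianNormGauss.normGaussSum_eq`). This is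
the local factor at the odd primes `p ∣ n` of the Gauss sum of the Hecke character of the
congruent number curve `E_n` (Koblitz, *Introduction to Elliptic Curves and Modular Forms*,
Ch. II §5, proof of the Theorem: the root number of `L(E_n, s)`), used in
`Literature.NumberTheory.EllipticCurves.CongruentNumberCurveRootNumber`. The proof is
elementary and avoids evaluating one-dimensional Gauss sums:

* `normGaussSum_gmul` — `S(w z) = χ(N w) S(z)` for `N(w) ≠ 0` (substitute `c ↦ c w̄`);
* `normGaussSum_zero` — `S(0) = 0` (multiply by `w` with `χ(N w) = -1`; every element of `𝔽_p`
  is a sum of two squares, Mathlib's `ZMod.sq_add_sq`);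
* `normGaussSum_of_norm_eq_zero` — `S(z) = 0` for `z ≠ 0`, `N(z) = 0` (then `-1 = i₀²` and
  `a² + b² = (a + i₀ b)(a - i₀ b)` splits the sum through `∑ χ = 0`);
* `normGaussSum_one` — `S(1, 0) = p`, by summing `S(λ, 0)` over `λ` in two ways
  (orthogonality of additive characters versus `S(λ, 0) = S(1, 0)` for `λ ≠ 0`).

Then, in terms of the finite Fourier transform `Literature.NumberTheory.LFunctions.GaussianTheta.fourier` of
`GaussianThetaFunctionalEquation`, for the coefficient `J_m(x) = (N(x)/m)` (Jacobi symbol of the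
norm, `Literature.NumberTheory.QuadraticFields.GaussianNormGauss.normJacobi`):

* `fourier_normJacobi_prime` — `Ĵ_p = (N·/p) · p` (`p` odd prime);
* `fourier_normJacobi` — **`Ĵ_m = (N·/m) · m` for every odd squarefree `m`**, by induction on the
  prime factorisation through the Chinese-remainder factorisation
  `GaussianTheta.fourier_mul_eq_of_coprime`.

## References

* N. Koblitz, *Introduction to Elliptic Curves and Modular Forms*, GTM 97, 2nd ed. (1993),
  Ch. II §5, proof of the Theorem (p. 84) — not held; the computation is classical
  (Gauss sums of quadratic forms), here carried out directly.
* K. Ireland, M. Rosen, *A Classical Introduction to Modern Number Theory*, 2nd ed. (1990),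
  Ch. 8 §2 (quadratic Gauss sums) — held.
-/

noncomputable section

/-! ### The Gauss sum `S(z)` over `𝔽_p × 𝔽_p` -/

namespace Literature.NumberTheory.QuadraticFields

namespace GaussianNormGauss

open ZMod

variable (p : ℕ) [Fact p.Prime]

/-- The two-dimensional quadratic Gauss sum of the norm form `a² + b²` over `𝔽_p`:
`S(z) = ∑_{(a,b) ∈ 𝔽_p²} ((a² + b²)/p) e^{2πi (a z₁ + b z₂)/p}`. [folklore] -/
def normGaussSum (z : ZMod p × ZMod p) : ℂ :=
  ∑ c : ZMod p × ZMod p, ((quadraticChar (ZMod p) (c.1 ^ 2 + c.2 ^ 2) : ℤ) : ℂ) *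
    stdAddChar (c.1 * z.1 + c.2 * z.2)

/-- Gaussian multiplication on pairs: `(c₁ + c₂ i)(w₁ + w₂ i)`. [folklore] -/
def gmul (w c : ZMod p × ZMod p) : ZMod p × ZMod p :=
  (c.1 * w.1 - c.2 * w.2, c.1 * w.2 + c.2 * w.1)

variable {p}

/-- The norm form is multiplicative under `gmul`. [folklore] -/
lemma norm_gmul (w c : ZMod p × ZMod p) :
    (gmul p w c).1 ^ 2 + (gmul p w c).2 ^ 2 = (c.1 ^ 2 + c.2 ^ 2) * (w.1 ^ 2 + w.2 ^ 2) := by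
  simp only [gmul]
  ring

/-- Multiplication by an element of nonzero norm is a bijection of `𝔽_p²`. [folklore] -/
lemma gmul_bijective {w : ZMod p × ZMod p} (hw : w.1 ^ 2 + w.2 ^ 2 ≠ 0) :
    Function.Bijective (gmul p w) := by
  refine Finite.injective_iff_bijective.1 fun c c' h ↦ ?_
  simp only [gmul, Prod.mk.injEq] at h
  obtain ⟨h1, h2⟩ := h
  have e1 : (c.1 - c'.1) * (w.1 ^ 2 + w.2 ^ 2) = 0 := by linear_combination w.1 * h1 + w.2 * h2
  have e2 : (c.2 - c'.2) * (w.1 ^ 2 + w.2 ^ 2) = 0 := by linear_combination -w.2 * h1 + w.1 * h2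
  exact Prod.ext (sub_eq_zero.1 ((mul_eq_zero.1 e1).resolve_right hw))
    (sub_eq_zero.1 ((mul_eq_zero.1 e2).resolve_right hw))

/-- **`S(w z) = χ(N w) S(z)`** for `N(w) ≠ 0` (substitute `c ↦ c w̄`). [folklore] -/
theorem normGaussSum_gmul {w : ZMod p × ZMod p} (hw : w.1 ^ 2 + w.2 ^ 2 ≠ 0)
    (z : ZMod p × ZMod p) :
    normGaussSum p (gmul p w z) =
      ((quadraticChar (ZMod p) (w.1 ^ 2 + w.2 ^ 2) : ℤ) : ℂ) * normGaussSum p z := by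
  unfold normGaussSum
  rw [Finset.mul_sum]
  have hw' : (w.1, -w.2).1 ^ 2 + (w.1, -w.2).2 ^ 2 ≠ 0 := by simpa using hw
  refine Fintype.sum_bijective (gmul p (w.1, -w.2)) (gmul_bijective hw') _ _ fun c ↦ ?_
  have hpair : c.1 * (gmul p w z).1 + c.2 * (gmul p w z).2 =
      (gmul p (w.1, -w.2) c).1 * z.1 + (gmul p (w.1, -w.2) c).2 * z.2 := by
    simp only [gmul]
    ring
  rw [hpair, norm_gmul, map_mul, show (w.1, -w.2).1 ^ 2 + (w.1, -w.2).2 ^ 2 = w.1 ^ 2 + w.2 ^ 2 by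
    simp only; ring]
  have h1 : ((quadraticChar (ZMod p) (w.1 ^ 2 + w.2 ^ 2) : ℤ) : ℂ) *
      ((quadraticChar (ZMod p) (w.1 ^ 2 + w.2 ^ 2) : ℤ) : ℂ) = 1 := by
    have := quadraticChar_sq_one hw
    rw [sq] at this
    exact_mod_cast this
  push_cast
  linear_combination -(((quadraticChar (ZMod p) (c.1 ^ 2 + c.2 ^ 2) : ℤ) : ℂ) *
    stdAddChar ((gmul p (w.1, -w.2) c).1 * z.1 + (gmul p (w.1, -w.2) c).2 * z.2)) * h1

/-- `S(z) = χ(N z) S(1, 0)` when `N(z) ≠ 0`. [folklore] -/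
theorem normGaussSum_of_norm_ne_zero {z : ZMod p × ZMod p} (hz : z.1 ^ 2 + z.2 ^ 2 ≠ 0) :
    normGaussSum p z =
      ((quadraticChar (ZMod p) (z.1 ^ 2 + z.2 ^ 2) : ℤ) : ℂ) * normGaussSum p (1, 0) := by
  rw [← normGaussSum_gmul hz]
  congr 1
  simp [gmul]

/-- `S(0) = 0`: multiply by an element whose norm is a non-residue (every element of `𝔽_p` is a
sum of two squares). [folklore] -/
theorem normGaussSum_zero (hp : p ≠ 2) : normGaussSum p 0 = 0 := by
  have hF : ringChar (ZMod p) ≠ 2 := by rwa [ZMod.ringChar_zmod_n]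
  obtain ⟨ν, hν⟩ := quadraticChar_exists_neg_one hF
  obtain ⟨a, b, hab⟩ := ZMod.sq_add_sq p ν
  have hw : (a, b).1 ^ 2 + (a, b).2 ^ 2 ≠ 0 := by
    simp only [hab]
    rintro rfl
    rw [MulChar.map_zero] at hν
    norm_num at hν
  have h := normGaussSum_gmul hw 0
  have h0 : gmul p (a, b) 0 = 0 := by simp [gmul]
  rw [h0, show (a, b).1 ^ 2 + (a, b).2 ^ 2 = ν from hab, hν] at h
  push_cast at h
  linear_combination h / 2

/-- `S(z) = 0` when `z ≠ 0` but `N(z) = 0` (then `-1 = i₀²` in `𝔽_p` and `a² + b² = UV` with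
`U = a + i₀ b`, `V = a - i₀ b`, `a z₁ + b z₂ = z₁ U`, so the sum factors through `∑_V χ(V) = 0`).
[folklore] -/
theorem normGaussSum_of_norm_eq_zero (hp : p ≠ 2) {z : ZMod p × ZMod p} (hz0 : z ≠ 0)
    (hz : z.1 ^ 2 + z.2 ^ 2 = 0) : normGaussSum p z = 0 := by
  have hF : ringChar (ZMod p) ≠ 2 := by rwa [ZMod.ringChar_zmod_n]
  have h2 : (2 : ZMod p) ≠ 0 := Ring.two_ne_zero hF
  have hz1 : z.1 ≠ 0 := by
    intro h1
    apply hz0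
    rw [h1] at hz
    have : z.2 = 0 := by simpa using hz
    exact Prod.ext h1 this
  set i₀ : ZMod p := z.2 / z.1 with hi₀
  have hi : i₀ ^ 2 = -1 := by
    rw [hi₀, div_pow, div_eq_iff (pow_ne_zero 2 hz1)]
    linear_combination hz
  have hi0 : i₀ ≠ 0 := by
    rintro h
    rw [h] at hi
    norm_num at hi
  -- the substitution `(a, b) ↦ (a + i₀ b, a - i₀ b)`
  let f : ZMod p × ZMod p → ZMod p × ZMod p := fun c ↦ (c.1 + i₀ * c.2, c.1 - i₀ * c.2)
  have hf : Function.Bijective f := by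
    refine Finite.injective_iff_bijective.1 fun c c' h ↦ ?_
    simp only [f, Prod.mk.injEq] at h
    obtain ⟨h1, h2'⟩ := h
    have e1 : 2 * (c.1 - c'.1) = 0 := by linear_combination h1 + h2'
    have e2 : (2 * i₀) * (c.2 - c'.2) = 0 := by linear_combination h1 - h2'
    refine Prod.ext (sub_eq_zero.1 ((mul_eq_zero.1 e1).resolve_left h2))
      (sub_eq_zero.1 ((mul_eq_zero.1 e2).resolve_left (mul_ne_zero h2 hi0)))
  have key : normGaussSum p z =
      ∑ d : ZMod p × ZMod p, ((quadraticChar (ZMod p) d.1 : ℤ) : ℂ) * stdAddChar (z.1 * d.1) *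
        ((quadraticChar (ZMod p) d.2 : ℤ) : ℂ) := by
    unfold normGaussSum
    refine Fintype.sum_bijective f hf _ _ fun c ↦ ?_
    simp only [f]
    have hN : c.1 ^ 2 + c.2 ^ 2 = (c.1 + i₀ * c.2) * (c.1 - i₀ * c.2) := by
      linear_combination (c.2 ^ 2) * hi
    have hL : c.1 * z.1 + c.2 * z.2 = z.1 * (c.1 + i₀ * c.2) := by
      rw [hi₀]
      field_simp
    rw [hN, hL, map_mul]
    push_cast
    ring
  have h0 : ∑ b : ZMod p, ((quadraticChar (ZMod p) b : ℤ) : ℂ) = 0 := by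
    have := quadraticChar_sum_zero hF
    exact_mod_cast congrArg (fun n : ℤ ↦ (n : ℂ)) this
  rw [key, Fintype.sum_prod_type]
  simp_rw [← Finset.mul_sum, h0, mul_zero, Finset.sum_const_zero]

/-- `∑_b χ(b²) = p - 1` (`χ(b²) = 1` for `b ≠ 0`). [folklore] -/
lemma sum_quadraticChar_sq :
    ∑ b : ZMod p, ((quadraticChar (ZMod p) (b ^ 2) : ℤ) : ℂ) = p - 1 := by
  have h : ∀ b : ZMod p, ((quadraticChar (ZMod p) (b ^ 2) : ℤ) : ℂ) = if b = 0 then 0 else 1 := by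
    intro b
    split_ifs with hb
    · simp [hb]
    · rw [quadraticChar_sq_one' hb]
      simp
  simp_rw [h]
  rw [Finset.sum_ite, Finset.sum_const_zero, zero_add, Finset.sum_const, nsmul_eq_mul, mul_one,
    Finset.filter_ne' Finset.univ (0 : ZMod p), Finset.card_erase_of_mem (Finset.mem_univ _),
    Finset.card_univ, ZMod.card]
  have : 1 ≤ p := (Fact.out : p.Prime).one_lt.le
  push_cast [Nat.cast_sub this]
  ring

/-- **`S(1, 0) = p`**: sum `S(λ, 0)` over `λ ∈ 𝔽_p` in two ways — by orthogonality of the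
additive characters it is `p ∑_b χ(b²) = p(p-1)`, and by `S(λ, 0) = χ(λ²) S(1, 0)` it is
`(p - 1) S(1, 0)`. [folklore] -/
theorem normGaussSum_one (hp : p ≠ 2) : normGaussSum p (1, 0) = p := by
  have hF : ringChar (ZMod p) ≠ 2 := by rwa [ZMod.ringChar_zmod_n]
  -- first evaluation
  have h1 : ∑ t : ZMod p, normGaussSum p (t, 0) = p * (p - 1) := by
    calc ∑ t : ZMod p, normGaussSum p (t, 0)
        = ∑ c : ZMod p × ZMod p, ((quadraticChar (ZMod p) (c.1 ^ 2 + c.2 ^ 2) : ℤ) : ℂ) *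
            ∑ t : ZMod p, stdAddChar (t * c.1) := by
          unfold normGaussSum
          rw [Finset.sum_comm]
          refine Finset.sum_congr rfl fun c _ ↦ ?_
          rw [Finset.mul_sum]
          refine Finset.sum_congr rfl fun t _ ↦ ?_
          simp only [mul_zero, add_zero, mul_comm c.1 t]
      _ = ∑ c : ZMod p × ZMod p,
            if c.1 = 0 then (p : ℂ) * ((quadraticChar (ZMod p) (c.2 ^ 2) : ℤ) : ℂ) else 0 := by
          refine Finset.sum_congr rfl fun c _ ↦ ?_
          rw [AddChar.sum_mulShift c.1 (ZMod.isPrimitive_stdAddChar p)]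
          split_ifs with hc
          · simp only [hc, ne_eq, OfNat.ofNat_ne_zero, not_false_eq_true, zero_pow, zero_add,
              ZMod.card]
            ring
          · simp
      _ = ∑ b : ZMod p, (p : ℂ) * ((quadraticChar (ZMod p) (b ^ 2) : ℤ) : ℂ) := by
          rw [Fintype.sum_prod_type, Finset.sum_comm]
          refine Finset.sum_congr rfl fun b _ ↦ ?_
          rw [Finset.sum_ite_eq' Finset.univ (0 : ZMod p)
            (fun _ ↦ (p : ℂ) * ((quadraticChar (ZMod p) (b ^ 2) : ℤ) : ℂ))]
          simp
      _ = p * (p - 1) := by rw [← Finset.mul_sum, sum_quadraticChar_sq]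
  -- second evaluation
  have h2 : ∑ t : ZMod p, normGaussSum p (t, 0) = (p - 1) * normGaussSum p (1, 0) := by
    have hterm : ∀ t : ZMod p, normGaussSum p (t, 0) = if t = 0 then 0 else normGaussSum p (1, 0) := by
      intro t
      split_ifs with ht
      · rw [ht]
        exact normGaussSum_zero hp
      · have hN : (t, (0 : ZMod p)).1 ^ 2 + (t, (0 : ZMod p)).2 ^ 2 ≠ 0 := by
          simpa using ht
        rw [normGaussSum_of_norm_ne_zero hN]
        dsimp only
        rw [show t ^ 2 + (0 : ZMod p) ^ 2 = t ^ 2 by ring, quadraticChar_sq_one' ht]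
        simp
    rw [Finset.sum_congr rfl fun t _ ↦ hterm t]
    rw [Finset.sum_ite, Finset.sum_const_zero, zero_add, Finset.sum_const, nsmul_eq_mul,
      Finset.filter_ne' Finset.univ (0 : ZMod p), Finset.card_erase_of_mem (Finset.mem_univ _),
      Finset.card_univ, ZMod.card]
    have : 1 ≤ p := (Fact.out : p.Prime).one_lt.le
    push_cast [Nat.cast_sub this]
    ring
  have hp1 : (p : ℂ) - 1 ≠ 0 := by
    have : (1 : ℝ) < p := by exact_mod_cast (Fact.out : p.Prime).one_lt
    intro h
    have h' : (p : ℂ) = 1 := by linear_combination h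
    have : (p : ℝ) = 1 := by exact_mod_cast h'
    linarith
  have := h1.symm.trans h2
  -- p (p-1) = (p-1) S
  have : ((p : ℂ) - 1) * (normGaussSum p (1, 0) - p) = 0 := by linear_combination -this
  rcases mul_eq_zero.1 this with h | h
  · exact absurd h hp1
  · linear_combination h

/-- **The norm-form Gauss sum**: `S(z) = χ(z₁² + z₂²) p` for every `z ∈ 𝔽_p²` (`p` odd).
[folklore] -/
theorem normGaussSum_eq (hp : p ≠ 2) (z : ZMod p × ZMod p) :
    normGaussSum p z = ((quadraticChar (ZMod p) (z.1 ^ 2 + z.2 ^ 2) : ℤ) : ℂ) * p := by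
  by_cases hz : z.1 ^ 2 + z.2 ^ 2 = 0
  · rw [hz, MulChar.map_zero, Int.cast_zero, zero_mul]
    rcases eq_or_ne z 0 with rfl | hz0
    · exact normGaussSum_zero hp
    · exact normGaussSum_of_norm_eq_zero hp hz0 hz
  · rw [normGaussSum_of_norm_ne_zero hz, normGaussSum_one hp]

end GaussianNormGauss

end Literature.NumberTheory.QuadraticFields

/-! ### The transform of `x ↦ (N(x)/m)` modulo an odd squarefree `m` -/

namespace Literature.NumberTheory.QuadraticFields

namespace GaussianNormGauss

open ZMod LFunctions.GaussianTheta

local notation "ℤ[i]" => GaussianInt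

/-- `N(x + m y) ≡ N(x) (mod m)`. [folklore] -/
theorem norm_add_natCast_mul_emod (m : ℕ) (x y : ℤ[i]) :
    (x + m * y).norm % m = x.norm % m := by
  have : (x + m * y).norm = x.norm +
      m * (2 * x.re * y.re + m * y.re * y.re + 2 * x.im * y.im + m * y.im * y.im) := by
    simp only [Zsqrtd.norm_def, Zsqrtd.re_add, Zsqrtd.im_add, Zsqrtd.re_mul, Zsqrtd.im_mul,
      Zsqrtd.re_natCast, Zsqrtd.im_natCast]
    ring
  rw [this, Int.add_mul_emod_self_left]

/-- The coefficient `J_m(x) = (N(x)/m)` (Jacobi symbol of the norm) on `ℤ[i]`. [folklore] -/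
def normJacobi (m : ℕ) (x : ℤ[i]) : ℂ := ((jacobiSym x.norm m : ℤ) : ℂ)

/-- `J_m` is periodic modulo `m`. [folklore] -/
theorem normJacobi_add_mul (m : ℕ) (x y : ℤ[i]) : normJacobi m (x + m * y) = normJacobi m x := by
  unfold normJacobi
  rw [jacobiSym.mod_left, norm_add_natCast_mul_emod, ← jacobiSym.mod_left]

/-- `J_m(c x) = J_m(x)` for an integer `c` prime to `m` (`N(c x) = c² N(x)`). [folklore] -/
theorem normJacobi_intCast_mul {m : ℕ} {c : ℤ} (hc : IsCoprime c m) (x : ℤ[i]) :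
    normJacobi m (c * x) = normJacobi m x := by
  unfold normJacobi
  rw [Zsqrtd.norm_mul, Zsqrtd.norm_intCast, ← sq, jacobiSym.mul_left,
    jacobiSym.sq_one' (Int.isCoprime_iff_gcd_eq_one.1 hc), one_mul]

/-- `J_{m₁ m₂} = J_{m₁} J_{m₂}`. [folklore] -/
theorem normJacobi_mul (m₁ m₂ : ℕ) [NeZero m₁] [NeZero m₂] (x : ℤ[i]) :
    normJacobi (m₁ * m₂) x = normJacobi m₁ x * normJacobi m₂ x := by
  unfold normJacobi
  rw [jacobiSym.mul_right, Int.cast_mul]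

/-- **Prime modulus**: `Ĵ_p(y) = (N(y)/p) · p` for an odd prime `p` — the transform
`fourier p J_p` is the norm-form Gauss sum `S(y mod p)` of Part A. [folklore] -/
theorem fourier_normJacobi_prime (p : ℕ) [Fact p.Prime] (hp : p ≠ 2) (y : ℤ[i]) :
    LFunctions.GaussianTheta.fourier p (normJacobi p) y = normJacobi p y * p := by
  have hcast : ∀ x : ℤ[i], normJacobi p x =
      ((quadraticChar (ZMod p) ((x.re : ZMod p) ^ 2 + (x.im : ZMod p) ^ 2) : ℤ) : ℂ) := by
    intro x
    rw [normJacobi, ← jacobiSym.legendreSym.to_jacobiSym, legendreSym, Zsqrtd.norm_def]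
    push_cast
    ring_nf
  have h1 : LFunctions.GaussianTheta.fourier p (normJacobi p) y =
      normGaussSum p ((y.re : ZMod p), (y.im : ZMod p)) := by
    unfold LFunctions.GaussianTheta.fourier normGaussSum
    refine Finset.sum_congr rfl fun c _ ↦ ?_
    rw [hcast]
    simp [rep, pairing]
  rw [h1, normGaussSum_eq hp, hcast]

/-- **Odd squarefree modulus**: `Ĵ_m(y) = (N(y)/m) · m` (`fourier m J_m`), by induction on the
number of prime factors through the Chinese-remainder factorisation
`GaussianTheta.fourier_mul_eq_of_coprime` (the Bezout twists `u₁, u₂` are prime to the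
moduli, so `J(u y) = J(y)`). [folklore] -/
theorem fourier_normJacobi : ∀ (m : ℕ) [NeZero m], Odd m → Squarefree m → ∀ y : ℤ[i],
    LFunctions.GaussianTheta.fourier m (normJacobi m) y = normJacobi m y * m := by
  intro m
  induction m using Nat.strong_induction_on with
  | _ m ih =>
  intro _ hodd hsq y
  rcases eq_or_ne m 1 with rfl | hm1
  · -- `m = 1`: one class, trivial symbol and character
    rw [LFunctions.GaussianTheta.fourier, Finset.sum_eq_single (0 : ZMod 1 × ZMod 1)]
    · simp [normJacobi, jacobiSym.one_right, pairing]
    · exact fun c _ hc ↦ absurd (Subsingleton.elim c 0) hc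
    · simp
  obtain ⟨p, hp, k, rfl⟩ := Nat.exists_prime_and_dvd hm1
  haveI := Fact.mk hp
  obtain ⟨hcop, -, hsqk⟩ := Nat.squarefree_mul_iff.1 hsq
  have hp0 : p ≠ 0 := hp.ne_zero
  have hk0 : k ≠ 0 := fun h ↦ by simp [h] at hodd
  haveI : NeZero p := ⟨hp0⟩
  haveI : NeZero k := ⟨hk0⟩
  have hkodd : Odd k := (Nat.odd_mul.1 hodd).2
  have hpodd : Odd p := (Nat.odd_mul.1 hodd).1
  have hp2 : p ≠ 2 := by rintro rfl; exact (Nat.not_even_iff_odd.2 hpodd) even_two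
  have hk_lt : k < p * k := lt_mul_left (Nat.pos_of_ne_zero hk0) hp.one_lt
  -- Bezout: `a p + b k = 1`
  have hcopZ : IsCoprime (p : ℤ) (k : ℤ) :=
    Int.isCoprime_iff_gcd_eq_one.mpr (by rw [Int.gcd_natCast_natCast]; exact hcop)
  obtain ⟨a, b, hab⟩ := hcopZ
  have hu₁ : b * k ≡ 1 [ZMOD p] := by
    refine Int.modEq_iff_dvd.2 ⟨a, ?_⟩
    linear_combination -hab
  have hu₂ : a * p ≡ 1 [ZMOD k] := by
    refine Int.modEq_iff_dvd.2 ⟨b, ?_⟩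
    linear_combination -hab
  have hb : IsCoprime b (p : ℤ) := ⟨k, a, by linear_combination hab⟩
  have ha : IsCoprime a (k : ℤ) := ⟨p, b, by linear_combination hab⟩
  have hψ : normJacobi (p * k) = fun x ↦ normJacobi p x * normJacobi k x := by
    funext x
    exact normJacobi_mul p k x
  rw [hψ, fourier_mul_eq_of_coprime hcop (normJacobi_add_mul p) (normJacobi_add_mul k) hu₁ hu₂ y,
    fourier_normJacobi_prime p hp2, ih k hk_lt hkodd hsqk, normJacobi_intCast_mul hb,
    normJacobi_intCast_mul ha]
  push_cast
  ring

end GaussianNormGauss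

end Literature.NumberTheory.QuadraticFields

end
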